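import Mathlib.Data.Finset.Card
import Mathlib.Data.List.Chain
import HarnessLib

/-!
# Rédei's theorem: semicomplete digraphs (tournaments) have Hamiltonian paths

A binary relation `r` is *semicomplete* on a finite set `N` when any two distinct members of `N` are related one way or
the other (a tournament when exactly one way).  RÉDEI (1934): every finite semicomplete digraph has a (directed)
Hamiltonian path, i.e. a listing `v₁, …, vₛ` of `N` without repetition with `r vᵢ vᵢ₊₁` for all `i`.
The proof is the classical insertion argument: insert a new vertex `a` in front of the first vertex it dominates
(or at the end).  Sources: Rédei, L., Ein kombinatorischer Satz, Acta Litt. Szeged 7 (1934) 39–43 (`Redei1934`);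
Jukna, S., Extremal Combinatorics (2011), Exercise 20.5 (`Jukna2011`: statement and the insertion hint);
Moon, J. W., Topics on Tournaments (1968) (`Moon1968`, terminology).

Main declarations: `Literature.Combinatorics.Digraph.Semicomplete`, `….IsHamPath`, `….insertPath`,
`….exists_isHamPath` (Rédei).
-/

namespace Literature.Combinatorics.Digraph

variable {α : Type*}

/-- `r` is **semicomplete** on `N`: any two distinct members of `N` are comparable under `r` (in at least one
direction) — a tournament when exactly one; we allow both. [cite: Jukna2011, Exercise 20.5] -/
def Semicomplete (r : α → α → Prop) (N : Finset α) : Prop :=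
  ∀ a ∈ N, ∀ b ∈ N, a ≠ b → r a b ∨ r b a

/-- Semicompleteness is inherited by subsets. [cite: Jukna2011, Exercise 20.5] -/
theorem Semicomplete.mono {r : α → α → Prop} {N M : Finset α} (h : Semicomplete r N) (hMN : M ⊆ N) :
    Semicomplete r M :=
  fun a ha b hb hab => h a (hMN ha) b (hMN hb) hab

/-- `l` is a **Hamiltonian `r`-path** of `N`: a repetition-free listing of exactly the members of `N` in which
consecutive entries are `r`-related. [cite: Jukna2011, Exercise 20.5] -/
structure IsHamPath (r : α → α → Prop) (N : Finset α) (l : List α) : Prop where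
  nodup : l.Nodup
  mem_iff : ∀ a, a ∈ l ↔ a ∈ N
  chain : l.IsChain r

/-- The empty list is a Hamiltonian path of the empty set (base of Rédei's induction). [cite: Jukna2011, Exercise 20.5] -/
theorem isHamPath_nil (r : α → α → Prop) : IsHamPath r (∅ : Finset α) [] :=
  ⟨List.nodup_nil, fun a => by simp, List.isChain_nil⟩

/-- A Hamiltonian path of `N` has length `N.card`. [cite: Jukna2011, Exercise 20.5] -/
theorem IsHamPath.length_eq [DecidableEq α] {r : α → α → Prop} {N : Finset α} {l : List α}
    (h : IsHamPath r N l) : l.length = N.card := by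
  have : l.toFinset = N := by ext a; rw [List.mem_toFinset]; exact h.mem_iff a
  rw [← this, List.toFinset_card_of_nodup h.nodup]

/-- **Insertion** of a vertex `a` into a path: in front of the first entry that `a` dominates, else at the end
(the "prolongation" of Jukna's hint). [cite: Jukna2011, Exercise 20.5] -/
def insertPath (r : α → α → Prop) [DecidableRel r] (a : α) : List α → List α
  | [] => [a]
  | b :: l => if r a b then a :: b :: l else b :: insertPath r a l

variable {r : α → α → Prop} [DecidableRel r]

/-- Membership in the inserted path. [folklore] -/
private theorem mem_insertPath {a x : α} : ∀ {l : List α}, x ∈ insertPath r a l ↔ x = a ∨ x ∈ l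
  | [] => by simp [insertPath]
  | b :: l => by
    unfold insertPath
    split_ifs
    · simp
    · rw [List.mem_cons, mem_insertPath, List.mem_cons]; tauto

/-- The inserted path has no repetition if the old one had none and `a` was new. [folklore] -/
private theorem nodup_insertPath {a : α} : ∀ {l : List α}, l.Nodup → a ∉ l → (insertPath r a l).Nodup
  | [], _, _ => List.nodup_singleton a
  | b :: l, hl, ha => by
    unfold insertPath
    split_ifs
    · exact List.nodup_cons.2 ⟨ha, hl⟩
    · rw [List.nodup_cons] at hl ⊢
      refine ⟨fun hb => ?_, nodup_insertPath hl.2 fun h => ha (List.mem_cons_of_mem _ h)⟩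
      rcases mem_insertPath.1 hb with rfl | hb'
      · exact ha List.mem_cons_self
      · exact hl.1 hb'

/-- The head of `insertPath r a (b :: l)` is `a` or `b`; we record the consequence we need: if `c` is related to both
candidates then `c :: insertPath r a (b :: l)` starts with an `r`-step. [folklore] -/
private theorem isChain_cons_insertPath {a c : α} :
    ∀ {l : List α}, r c a → (c :: l).IsChain r → (∀ x ∈ l, r a x ∨ r x a) → (c :: insertPath r a l).IsChain r
  | [], hca, _, _ => by simpa [insertPath, List.isChain_pair] using hca
  | b :: l, hca, hcl, hal => by
    unfold insertPath
    rw [List.isChain_cons_cons] at hcl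
    split_ifs with hab
    · exact List.isChain_cons_cons.2 ⟨hca, List.isChain_cons_cons.2 ⟨hab, hcl.2⟩⟩
    · have hba : r b a := by
        rcases hal b List.mem_cons_self with h | h
        · exact absurd h hab
        · exact h
      exact List.isChain_cons_cons.2
        ⟨hcl.1, isChain_cons_insertPath hba hcl.2 fun x hx => hal x (List.mem_cons_of_mem _ hx)⟩

/-- The inserted path is an `r`-chain, provided `a` is comparable with every old entry. [folklore] -/
private theorem isChain_insertPath {a : α} :
    ∀ {l : List α}, l.IsChain r → (∀ x ∈ l, r a x ∨ r x a) → (insertPath r a l).IsChain r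
  | [], _, _ => List.isChain_singleton a
  | b :: l, hl, hal => by
    unfold insertPath
    split_ifs with hab
    · exact List.isChain_cons_cons.2 ⟨hab, hl⟩
    · have hba : r b a := by
        rcases hal b List.mem_cons_self with h | h
        · exact absurd h hab
        · exact h
      exact isChain_cons_insertPath hba hl fun x hx => hal x (List.mem_cons_of_mem _ hx)

/-- Inserting a new comparable vertex into a Hamiltonian path of `N` gives a Hamiltonian path of `insert a N`.
[cite: Jukna2011, Exercise 20.5] -/
theorem IsHamPath.insert [DecidableEq α] {N : Finset α} {l : List α} {a : α} (hl : IsHamPath r N l)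
    (ha : a ∉ N) (hcomp : ∀ x ∈ N, r a x ∨ r x a) : IsHamPath r (insert a N) (insertPath r a l) where
  nodup := nodup_insertPath hl.nodup fun h => ha ((hl.mem_iff a).1 h)
  mem_iff x := by rw [mem_insertPath, Finset.mem_insert, hl.mem_iff]
  chain := isChain_insertPath hl.chain fun x hx => hcomp x ((hl.mem_iff x).1 hx)

/-- **Rédei's theorem (1934).**  A semicomplete digraph on a finite set has a Hamiltonian path.
[cite: Jukna2011, Exercise 20.5] [cite: Redei1934, Satz p. 39] -/
theorem exists_isHamPath [DecidableEq α] {N : Finset α} (h : Semicomplete r N) : ∃ l : List α, IsHamPath r N l := by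
  induction N using Finset.induction_on with
  | empty => exact ⟨[], isHamPath_nil r⟩
  | insert a N ha ih =>
    obtain ⟨l, hl⟩ := ih (h.mono (Finset.subset_insert a N))
    refine ⟨insertPath r a l, hl.insert ha fun x hx => ?_⟩
    exact h a (Finset.mem_insert_self a N) x (Finset.mem_insert_of_mem hx) (by rintro rfl; exact ha hx)

end Literature.Combinatorics.Digraph
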